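import Summits.BirchSwinnertonDyer.BirchSwinnertonDyer.Theses.TameQuarticManinParity
import Summits.BirchSwinnertonDyer.BirchSwinnertonDyer.Theorems.TameQuarticManinParityTprimeIrrModThreeSaturationOfGaloisFacts
import HarnessLib

/-!
# Crux MS `TprimeIrrModThreeSaturation` (stmt-BirchSwinnertonDyer-23367) — LINE `abelian-fixed-points`, lead skeleton v7
# (lead `cruxlead-stmt-BirchSwinnertonDyer-23367` g5; v6 = g3/g4, same mathematics)

`TprimeIrrModThreeSaturation_of` concludes the crux BY NAME from ONE registered stub whose signature is, verbatim, the
conjunction of the THREE catalogued Galois-side named facts that are the crux's entire open content (every other input of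
the line — Knapp 11.22, E32a, E32b, E30, B30, H2, W23b, LIFT33, FIN34a/b, X35, RIG35/G35, G33/G34 and all glue — is a
landed theorem; the composition is the landed `tprimeIrrModThreeSaturation_of_galoisFacts`, p689429):

* (E)  `Literature.NumberTheory.Automorphic.edixhoven1992_serreWeight_le_weight_of_newform` — Edixhoven 1992, Invent.
  Math. 109, Thm. 4.5 minimality clause (p. 572): Serre's weight ≤ the weight of a prime-to-`p`-level newform giving `ρ̄`;
* (D)  `Literature.NumberTheory.Automorphic.darmonDiamondTaylor1995_ordinary_of_weightTwo_newform_dvd_level` —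
  Darmon–Diamond–Taylor 1995, Thm. 3.1 (g) (p. 86, with p. 87): `ρ_{g,p}|G_p` ordinary for a weight-2 newform with `p ∥ N_g`;
* (61) `Literature.NumberTheory.EllipticCurves.ModularForms.DeligneSerre1974.thm61_exists_adicGaloisRep` — Deligne 1971 /
  Deligne–Serre 1974 Thm. 6.1 (p. 520): `λ`-adic representations attached to weight-`≥ 2` eigenforms.

v6 registered the stub as the route decl L31 `TprimeIrrLevelThirdAvoidsThree` (stmt-23690); L31 ⇐ (E) ∧ (D) ∧ (61) is the
landed `levelThirdAvoidsThree_of_namedFacts` (p685633), so v7 only moves the `sorry` onto the facts themselves: the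
registered stub list now NAMES the debt.  Each conjunct is an XL Literature formalisation (modular curves over ℤ[1/N],
Jacobians / étale cohomology, p-adic Hodge theory — none in Mathlib): factops typing, not stub work.
No multiplicity one anywhere.  CONDITIONAL BY NATURE.  No summit is proved; BSD is NOT proved.
-/

set_option autoImplicit false
-- D-0017: single-problem summit, so `Summit.BirchSwinnertonDyer.BirchSwinnertonDyer.…` repeats a namespace BY DESIGN.
set_option linter.dupNamespace false

noncomputable section

namespace Summit.BirchSwinnertonDyer.BirchSwinnertonDyer.Theorems.TameQuarticManinParity

open Summit.BirchSwinnertonDyer.BirchSwinnertonDyer.Theses.TameQuarticManinParity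

/-- STUB (the crux's entire open content): the three catalogued Galois-side named facts (E) Edixhoven 1992 Thm. 4.5,
(D) Darmon–Diamond–Taylor 1995 Thm. 3.1 (g), (61) Deligne–Serre 1974 Thm. 6.1 — each a cite-only `def … : Prop` of the
Literature library awaiting its `_holds` (XL formalisations).  Equivalent registered reading: L31
`TprimeIrrLevelThirdAvoidsThree` (stmt-23690) via `levelThirdAvoidsThree_of_namedFacts`. -/
theorem stub_galoisFacts :
    Literature.NumberTheory.Automorphic.edixhoven1992_serreWeight_le_weight_of_newform ∧
    Literature.NumberTheory.Automorphic.darmonDiamondTaylor1995_ordinary_of_weightTwo_newform_dvd_level ∧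
    Literature.NumberTheory.EllipticCurves.ModularForms.DeligneSerre1974.thm61_exists_adicGaloisRep := by
  sorry

/-- **The crux MS by name, modulo the one open stub** = (E) ∧ (D) ∧ (61), through the landed conditional closure
`tprimeIrrModThreeSaturation_of_galoisFacts` (p689429: MS ⇐ A29 ⇐ H1 ∧ H2, H2 proved p689060, H1 ⇐ L31 ⇐ E, D, 61).
[folklore] -/
theorem TprimeIrrModThreeSaturation_of : TprimeIrrModThreeSaturation :=
  tprimeIrrModThreeSaturation_of_galoisFacts stub_galoisFacts.1 stub_galoisFacts.2.1 stub_galoisFacts.2.2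

end Summit.BirchSwinnertonDyer.BirchSwinnertonDyer.Theorems.TameQuarticManinParity

end
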